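import Mathlib
import Literature.NumberTheory.Automorphic.HilbertModularFormQExpansion
import Summits.Langlands.Langlands.Theorems.CapacityClassicalityHilbertIntegralOverconvergentIsCongruenceFourierKoecher

/-!
# The `q`-expansion principle over `ℂ` for `𝓞 F`-periodic holomorphic functions on `ℍ^{Hom(F,ℝ)}`

Stub P3 (`stub_qExpansion_injective`) of line Sketch-ideate-r1-k1 of the crux
`HilbertIntegralOverconvergentIsCongruence` (stmt-Langlands-8485): for `F` totally real, two holomorphic
`𝓞 F`-periodic functions `f, g` on the tube domain `ℍ` whose Fourier coefficients
`HilbertModular.fourierCoeff` agree on the dual lattice `𝔡⁻¹ = {ν : Tr(ν a) ∈ ℤ for all a ∈ 𝓞 F}` agree on `ℍ`.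

Proof: by the landed Fourier expansion `hasSum_fourierCoeff` (Freitag, *Hilbert Modular Forms*, Ch. I
Lemma 4.1) both `f z` and `g z` are sums of the Fourier series `∑_{ν ∈ 𝔡⁻¹} a_ν e^{2πi S(νz)}`; after
rewriting the coefficients of `f` into those of `g` (`HasSum.congr_fun`) the two series coincide, and sums
of a `HasSum` are unique (`HasSum.unique`, `ℂ` being Hausdorff).
-/

set_option linter.dupNamespace false

noncomputable section

namespace Summit.Langlands.Langlands.Theorems.HilbertIntegralOverconvergentIsCongruence

open MeasureTheory Complex NumberField
open Literature.NumberTheory.Automorphic Literature.NumberTheory.Automorphic.HilbertModular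

/-- **stub P3 — `stub_qExpansion_injective`.** The `q`-expansion principle over `ℂ`: two holomorphic
`𝓞 F`-periodic functions on `ℍ` with the same Fourier coefficients on the dual lattice agree on `ℍ` (both are
the sum of the same Fourier series, landed `hasSum_fourierCoeff`). [cite: Freitag1990, Ch. I Lemma 4.1] -/
theorem stub_qExpansion_injective (F : Type) [Field F] [NumberField F] [NumberField.IsTotallyReal F] (f g : Point F → ℂ)
    (hf : IsHolomorphicOn F f) (hg : IsHolomorphicOn F g)
    (hperf : ∀ (a : 𝓞 F) (z : Point F), z ∈ halfSpace F → f (fun σ ↦ z σ + ((σ (a : F) : ℝ) : ℂ)) = f z)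
    (hperg : ∀ (a : 𝓞 F) (z : Point F), z ∈ halfSpace F → g (fun σ ↦ z σ + ((σ (a : F) : ℝ) : ℂ)) = g z)
    (hcoef : ∀ μ : F, (∀ a : 𝓞 F, ∃ n : ℤ, Algebra.trace ℚ F (μ * a) = n) → fourierCoeff f μ = fourierCoeff g μ) :
    ∀ z ∈ halfSpace F, f z = g z := by
  intro z hz
  -- the Fourier expansions of `f` and `g` at `z`
  have hF := (hasSum_fourierCoeff F f hf hperf z hz).1
  have hG := (hasSum_fourierCoeff F g hg hperg z hz).1
  -- the series of `f` is the series of `g`, coefficient by coefficient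
  have hF' : HasSum (fun ν : {ν : F | ∀ a : 𝓞 F, ∃ n : ℤ, Algebra.trace ℚ F (ν * a) = n} ↦
      fourierCoeff g ν * cexp (2 * Real.pi * I * pairing (ν : F) z)) (f z) :=
    hF.congr_fun fun ν ↦ by rw [hcoef ν ν.2]
  exact hF'.unique hG

end Summit.Langlands.Langlands.Theorems.HilbertIntegralOverconvergentIsCongruence
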